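import Literature.IUT.HodgeArakelov.AbsTopInterfaces

/-!
# [IUTchII] §1, Example 1.8 (i)/(viii): the quotient `Π ↦ Π/Δ` is functorial in isomorphisms `Π ≅ Π*`

Mochizuki, *Inter-universal Teichmüller theory II*, §1, Example 1.8 (i), kurims manuscript (Dec. 2020)
pp. 35–36 [claim: Mochizuki2012, status: disputed] (IUTchII §1 Ex 1.8 (i), kurims pp.35-36). Record-only
typing under the claim key `Mochizuki2012` (D-0012, disputed); abc-iut cell, layer L6 (sub-DAG of
`IUTchII:Cor1.11`, holder abc-iut-w5-d089, row S4: the `Π`-functoriality input of the functor `ℛ → ℱ` of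
Corollary 1.11 — this file supplies its FIRST component unconditionally).

Example 1.8 (i) (p. 35): the radial datum `(Π, G, α)` involves "the full poly-isomorphism `α : Π/Δ ≅ G`",
where `Δ ⊆ Π` is the group-theoretic subgroup of the interface `AbsTopMonoids` (`Delta`, preserved by
isomorphisms: `Delta_map`). An isomorphism of radial data "is defined to be a pair of isomorphisms of
topological groups `Π ≅ Π*`, `G ≅ G*` [which are necessarily compatible with `α, α*`!]" (p. 36) — the
compatibility being automatic BECAUSE `Π ≅ Π*` INDUCES an isomorphism of topological groups
`Π/Δ ≅ Π*/Δ*`. This file CONSTRUCTS that induced isomorphism over abc-iut-L6-t1's interface (real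
topology: continuity in both directions from the quotient maps) and proves its functor laws:

* `AbsTopMonoids.quotMap A h : (Π/Δ ≅ Π*/Δ*)` for `h : Π ≅ Π*` — DEFINED (`QuotientGroup.congr` along
  `Delta_map`, continuity via `QuotientGroup.isQuotientMap_mk`);
* `quotMap_mk` (it is the induced map on cosets), `quotMap_id`, `quotMap_comp` — PROVED.

Generic over the interface; no named fact; nothing here bears on [IUTchIII] Cor. 3.12.
-/

namespace Literature.IUT.HodgeArakelov

open CategoryTheory

universe u

variable {S : ThetaSetting.{u}} (A : AbsTopMonoids S)

namespace AbsTopMonoids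

/-- `Δ` is carried onto `Δ*` by (the group isomorphism underlying) `h : Π ≅ Π*` — the interface law
`Delta_map`, restated for the `MulEquiv`. [claim: Mochizuki2012, status: disputed]
(IUTchII §1 Ex 1.8 (i), kurims p.35) -/
theorem Delta_map_toMulEquiv {P Q : IsoClass S.PiX} (h : P ⟶ Q) :
    (A.Delta P).map (IsoClass.homIso h).toMulEquiv = A.Delta Q := by
  rw [← A.Delta_map h]
  rfl

/-- **IUTchII:Ex1.8(i)** (kurims pp. 35–36): the isomorphism of topological groups `Π/Δ ≅ Π*/Δ*` INDUCED by
an isomorphism `h : Π ≅ Π*` (so that isomorphisms of radial data are "necessarily compatible with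
`α, α*`"), as a morphism of `IsoClass G_k` between the objects `Π/Δ`, `Π*/Δ*`. DEFINED: the group
isomorphism is `QuotientGroup.congr` along `Delta_map`; continuity of it and of its inverse from the
quotient maps `Π ↠ Π/Δ`, `Π* ↠ Π*/Δ*`. [claim: Mochizuki2012, status: disputed] (IUTchII §1 Ex 1.8 (i), kurims pp.35-36) -/
def quotMap {P Q : IsoClass S.PiX} (h : P ⟶ Q) :
    (⟨TopGroup.quot P.G (A.Delta P), A.quotIso P⟩ : IsoClass S.Gk) ⟶
      ⟨TopGroup.quot Q.G (A.Delta Q), A.quotIso Q⟩ :=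
  { toMulEquiv := QuotientGroup.congr (A.Delta P) (A.Delta Q) (IsoClass.homIso h).toMulEquiv
      (A.Delta_map_toMulEquiv h)
    continuous_toFun := by
      refine (QuotientGroup.isQuotientMap_mk (A.Delta P)).continuous_iff.2 ?_
      exact QuotientGroup.continuous_mk.comp (IsoClass.homIso h).continuous
    continuous_invFun := by
      refine (QuotientGroup.isQuotientMap_mk (A.Delta Q)).continuous_iff.2 ?_
      exact QuotientGroup.continuous_mk.comp (IsoClass.homIso h).symm.continuous }

/-- `quotMap h` IS the induced map on cosets: `[x] ↦ [h x]`. [claim: Mochizuki2012, status: disputed]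
(IUTchII §1 Ex 1.8 (i), kurims pp.35-36) -/
@[simp] theorem quotMap_mk {P Q : IsoClass S.PiX} (h : P ⟶ Q) (x : P.G) :
    IsoClass.homIso (A.quotMap h) (QuotientGroup.mk x : P.G ⧸ A.Delta P) =
      (QuotientGroup.mk (IsoClass.homIso h x) : Q.G ⧸ A.Delta Q) := rfl

/-- Functor law: `quotMap (𝟙 Π) = 𝟙 (Π/Δ)`. [claim: Mochizuki2012, status: disputed]
(IUTchII §1 Ex 1.8 (i), kurims pp.35-36) -/
theorem quotMap_id (P : IsoClass S.PiX) : A.quotMap (𝟙 P) = 𝟙 _ := by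
  apply ContinuousMulEquiv.ext
  intro x
  induction x using QuotientGroup.induction_on with
  | H x => rfl

/-- Functor law: `quotMap (h ≫ h') = quotMap h ≫ quotMap h'`. [claim: Mochizuki2012, status: disputed]
(IUTchII §1 Ex 1.8 (i), kurims pp.35-36) -/
theorem quotMap_comp {P Q R : IsoClass S.PiX} (h : P ⟶ Q) (h' : Q ⟶ R) :
    A.quotMap (h ≫ h') = A.quotMap h ≫ A.quotMap h' := by
  apply ContinuousMulEquiv.ext
  intro x
  induction x using QuotientGroup.induction_on with
  | H x => rfl

/-- Hence `Π ↦ Π/Δ` is a FUNCTOR `IsoClass Π^tp_{X̲̲_k} ⥤ IsoClass G_k` ("functorial group-theoretic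
algorithm", Ex. 1.8 (i)/(ii): the surjection `Π ↠ Π/Δ`). [claim: Mochizuki2012, status: disputed]
(IUTchII §1 Ex 1.8 (i), kurims pp.35-36) -/
def quotFunctor : IsoClass S.PiX ⥤ IsoClass S.Gk where
  obj P := ⟨TopGroup.quot P.G (A.Delta P), A.quotIso P⟩
  map h := A.quotMap h
  map_id P := A.quotMap_id P
  map_comp h h' := A.quotMap_comp h h'

end AbsTopMonoids

end Literature.IUT.HodgeArakelov
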